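import Mathlib.MeasureTheory.Integral.Bochner.Basic
import Mathlib.Probability.Moments.Covariance
import Mathlib.Order.Partition.Finpartition
import Mathlib.MeasureTheory.Group.Arithmetic
import Mathlib.Algebra.GroupWithZero.Units.Fintype
import Mathlib.Algebra.Order.Monoid.Units
import HarnessLib

-- provenance: harness21/H21/H21/Prelude/StatMech/Correlations.lean @ ad525e2 (interim HEAD d8f2665); M5 mechanical rewrite
/-!
# Correlation functions of random fields and Ising spin configurations

Trunk G02 (T-STATMECH), prelude item P3 `Correlations` (notion `lattice_correlation_functions`).

## Contents

*Generic part.* For a measure `μ` on `Ω` and a real random field `φ : X → Ω → ℝ` we define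

* `nPoint μ φ x = ⟨φ(x₁) ⋯ φ(xₙ)⟩ = ∫ ∏ i, φ (x i) ω ∂μ` (the `n`-point function),
  `onePoint`, `twoPoint` (expectations of products, never covariances);
* `truncatedTwoPoint μ φ x y = cov[φ x, φ y; μ]` — this *is* Mathlib's
  `ProbabilityTheory.covariance`; we only give it its physics name and the bridge
  `truncatedTwoPoint_eq` (from `ProbabilityTheory.covariance_eq_sub`);
* `blockMoment`, `ursell` (truncated / connected `n`-point function, Möbius inversion over set
  partitions, `Finpartition`), `connectedFour` (the explicit even-field formula
  `⟨1234⟩ - ⟨12⟩⟨34⟩ - ⟨13⟩⟨24⟩ - ⟨14⟩⟨23⟩`) and `connectedFour_eq_ursell_of_odd_vanish`.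

*Spin part.* `SpinConfig V := V → ℤˣ` with the product partial order (Mathlib's
`LinearOrder ℤˣ`, so FKG-type statements use `Monotone`), the spin observables `spinAt`,
`spinProduct` (`σ_A = ∏_{x ∈ A} σ_x`, set form), `spinMonomial`, `spinPair`, and the correlations
`spinCorr μ A = ⟨σ_A⟩`, `spinTwoPoint μ x y = ⟨σ_x σ_y⟩`. Two-point functions are expectations
of products (so `spinTwoPoint μ x x = 1`), never `spinCorr μ {x, y}`.

## Mathlib status

Mathlib has `integral`, `ProbabilityTheory.covariance` (used verbatim for the truncated two-point
function) and `Finpartition` with a `Fintype` instance; it has no `n`-point / Ursell functions.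
`Units.instMeasurableSpace : MeasurableSpace ℤˣ` is the comap of the structure on `ℤ` along
`Units.val`; Mathlib does not record that it is discrete, so we provide the (new, non-overriding)
instance `DiscreteMeasurableSpace ℤˣ`, whence `MeasurableSingletonClass ℤˣ`.

## References

* J. Glimm, A. Jaffe, *Quantum Physics: A Functional Integral Point of View*, 2nd ed. (1987),
  §4.2 (Schwinger functions), Ch. 4 & 17 (Ursell functions, Lebowitz inequality).
* S. Friedli, Y. Velenik, *Statistical Mechanics of Lattice Systems* (CUP 2017), §3.2–3.6
  (Ising spins, correlation functions `⟨σ_A⟩`, GKS/FKG).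
* B. Simon, *The Statistical Mechanics of Lattice Gases* I (1993), §II.12 (Ursell functions).
-/

noncomputable section

open MeasureTheory ProbabilityTheory
open scoped ProbabilityTheory

namespace Literature.Probability.LatticeModels

/-! ### Generic correlation functions of a real random field -/

section Generic

variable {Ω X : Type*} [MeasurableSpace Ω]

/-- The `n`-point (Schwinger / correlation) function of the real random field `φ` under `μ`:
`⟨φ(x₁) ⋯ φ(xₙ)⟩_μ = ∫ ∏ i, φ (x i) ω ∂μ` (Glimm–Jaffe 1987, §4.2 and §6.1). Junk value `0`
if the product is not integrable (Bochner integral convention). [cite: GlimmJaffe1987, §4.2 and §6.1] -/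
def nPoint (μ : Measure Ω) (φ : X → Ω → ℝ) {n : ℕ} (x : Fin n → X) : ℝ :=
  ∫ ω, ∏ i, φ (x i) ω ∂μ

/-- The one-point function `⟨φ(x)⟩_μ = ∫ φ x ∂μ` (magnetisation profile; Friedli–Velenik 2017,
§3.2). [cite: FriedliVelenik2017, §3.2] -/
def onePoint (μ : Measure Ω) (φ : X → Ω → ℝ) (x : X) : ℝ :=
  ∫ ω, φ x ω ∂μ

/-- The (full, untruncated) two-point function `⟨φ(x) φ(y)⟩_μ = ∫ φ x ω * φ y ω ∂μ`, an
expectation of a product (Glimm–Jaffe 1987, §4.2; Friedli–Velenik 2017, §3.2). [cite: GlimmJaffe1987, §4.2] -/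
def twoPoint (μ : Measure Ω) (φ : X → Ω → ℝ) (x y : X) : ℝ :=
  ∫ ω, φ x ω * φ y ω ∂μ

/-- The two-point function is the `2`-point function at `![x, y]` (Glimm–Jaffe 1987, §4.2). [cite: GlimmJaffe1987, §4.2] -/
theorem twoPoint_eq_nPoint (μ : Measure Ω) (φ : X → Ω → ℝ) (x y : X) :
    twoPoint μ φ x y = nPoint μ φ ![x, y] := by
  simp [twoPoint, nPoint, Fin.prod_univ_two]

/-- The one-point function is the `1`-point function (Glimm–Jaffe 1987, §4.2). [cite: GlimmJaffe1987, §4.2] -/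
theorem onePoint_eq_nPoint (μ : Measure Ω) (φ : X → Ω → ℝ) (x : X) :
    onePoint μ φ x = nPoint μ φ ![x] := by
  simp [onePoint, nPoint]

/-- The two-point function is symmetric (Glimm–Jaffe 1987, §4.2). [cite: GlimmJaffe1987, §4.2] -/
theorem twoPoint_comm (μ : Measure Ω) (φ : X → Ω → ℝ) (x y : X) :
    twoPoint μ φ x y = twoPoint μ φ y x := by
  simp [twoPoint, mul_comm]

/-- The truncated (connected) two-point function
`⟨φ(x); φ(y)⟩_μ = ⟨(φ(x) - ⟨φ(x)⟩)(φ(y) - ⟨φ(y)⟩)⟩`; this is exactly Mathlib's covariance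
`cov[φ x, φ y; μ]` (Glimm–Jaffe 1987, §4.2; Friedli–Velenik 2017, §3.7). [cite: GlimmJaffe1987, §4.2] -/
def truncatedTwoPoint (μ : Measure Ω) (φ : X → Ω → ℝ) (x y : X) : ℝ :=
  cov[φ x, φ y; μ]

/-- For square-integrable fields under a probability measure,
`⟨φ(x); φ(y)⟩ = ⟨φ(x) φ(y)⟩ - ⟨φ(x)⟩⟨φ(y)⟩` (Glimm–Jaffe 1987, §4.2; Mathlib
`ProbabilityTheory.covariance_eq_sub`). [cite: GlimmJaffe1987, §4.2] -/
theorem truncatedTwoPoint_eq (μ : Measure Ω) [IsProbabilityMeasure μ] (φ : X → Ω → ℝ) (x y : X)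
    (hx : MemLp (φ x) 2 μ) (hy : MemLp (φ y) 2 μ) :
    truncatedTwoPoint μ φ x y = twoPoint μ φ x y - onePoint μ φ x * onePoint μ φ y := by
  simp only [truncatedTwoPoint, covariance_eq_sub hx hy, twoPoint, onePoint]
  rfl

/-- The block moment `⟨φ_B⟩ = ∫ ∏ i ∈ B, φ (x i) ω ∂μ` of the sub-family of `x : Fin n → X`
indexed by `B : Finset (Fin n)`; the building block of the Ursell expansion (Simon 1993,
§II.12). [cite: Simon1993, §II.12] -/
def blockMoment (μ : Measure Ω) (φ : X → Ω → ℝ) {n : ℕ} (x : Fin n → X)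
    (B : Finset (Fin n)) : ℝ :=
  ∫ ω, ∏ i ∈ B, φ (x i) ω ∂μ

/-- The block moment of the full index set is the `n`-point function (Simon 1993, §II.12). [cite: Simon1993, §II.12] -/
theorem blockMoment_univ (μ : Measure Ω) (φ : X → Ω → ℝ) {n : ℕ} (x : Fin n → X) :
    blockMoment μ φ x Finset.univ = nPoint μ φ x := rfl

/-- The Ursell (truncated, connected, cumulant) `n`-point function, defined by Möbius inversion
over the lattice of set partitions of `{1, …, n}`:
`uₙ(x) = ∑_P (-1)^{|P|-1} (|P|-1)! ∏_{B ∈ P} ⟨φ_B⟩`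
(Simon 1993, §II.12, eq. (II.12.3); Glimm–Jaffe 1987, §17.4). For `n = 0` the only partition is
the empty one and the value is the junk value `1` (`ℕ`-subtraction `0 - 1 = 0`); the definition is
only used for `n ≥ 1`. [cite: Simon1993, §II.12  eq. (II.12.3] -/
def ursell (μ : Measure Ω) (φ : X → Ω → ℝ) {n : ℕ} (x : Fin n → X) : ℝ :=
  ∑ P : Finpartition (Finset.univ : Finset (Fin n)),
    (-1 : ℝ) ^ (P.parts.card - 1) * ((P.parts.card - 1).factorial : ℝ) *
      ∏ B ∈ P.parts, blockMoment μ φ x B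

/-- The connected four-point function of an *even* field, in the explicit pairing form
`U₄(x₁,x₂,x₃,x₄) = ⟨1234⟩ - ⟨12⟩⟨34⟩ - ⟨13⟩⟨24⟩ - ⟨14⟩⟨23⟩` used in the Lebowitz and
Aizenman–Fröhlich inequalities (Glimm–Jaffe 1987, §4.3 and Cor. 4.3.3; Aizenman 1982). [cite: GlimmJaffe1987, §4.3 and Cor. 4.3.3] -/
def connectedFour (μ : Measure Ω) (φ : X → Ω → ℝ) (x : Fin 4 → X) : ℝ :=
  nPoint μ φ x - twoPoint μ φ (x 0) (x 1) * twoPoint μ φ (x 2) (x 3)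
    - twoPoint μ φ (x 0) (x 2) * twoPoint μ φ (x 1) (x 3)
    - twoPoint μ φ (x 0) (x 3) * twoPoint μ φ (x 1) (x 2)

/-- If all odd block moments of `x : Fin 4 → X` vanish (e.g. for an even measure), the Ursell
four-point function reduces to the pairing formula `connectedFour`
(Glimm–Jaffe 1987, §4.3; Simon 1993, §II.12). [cite: GlimmJaffe1987, §4.3] -/
def connectedFour_eq_ursell_of_odd_vanish : Prop :=
  ∀ (μ : Measure Ω) (φ : X → Ω → ℝ) (x : Fin 4 → X) (hodd : ∀ B : Finset (Fin 4), Odd B.card → blockMoment μ φ x B = 0),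
    connectedFour μ φ x = ursell μ φ x

end Generic

end Literature.Probability.LatticeModels

/-! ### The discrete measurable structure on `ℤˣ` -/

/-- Mathlib's `Units.instMeasurableSpace : MeasurableSpace ℤˣ` is the comap along `Units.val` of
the (discrete) structure on `ℤ`; hence every subset of `ℤˣ` is measurable. This new instance
(not an override) provides `MeasurableSingletonClass ℤˣ`, needed to integrate spin observables
(Friedli–Velenik 2017, §3.1 and §6.2). [cite: FriedliVelenik2017, §3.1 and §6.2] -/
instance Literature.Probability.LatticeModels.instDiscreteMeasurableSpaceUnitsInt : DiscreteMeasurableSpace ℤˣ where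
  forall_measurableSet s :=
    ⟨Units.val '' s, (Set.to_countable _).measurableSet, Set.preimage_image_eq s Units.val_injective⟩

namespace Literature.Probability.LatticeModels

/-! ### Ising spin configurations and spin correlations -/

section Spin

variable {V : Type*}

/-- Ising spin configurations on the vertex set `V`: maps `σ : V → ℤˣ = {1, -1}`. As a Pi type
over the linear order `ℤˣ` (`-1 < 1`) it carries the product partial order used in FKG
(Friedli–Velenik 2017, §3.1 and §3.6.2). [cite: FriedliVelenik2017, §3.1 and §3.6.2] -/
abbrev SpinConfig (V : Type*) := V → ℤˣ

/-- The spin at `x` as a real number, `σ_x ∈ {-1, 1} ⊆ ℝ` (Friedli–Velenik 2017, §3.1). [cite: FriedliVelenik2017, §3.1] -/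
def spinAt (x : V) (s : SpinConfig V) : ℝ :=
  ((s x : ℤ) : ℝ)

/-- The spin product `σ_A = ∏_{x ∈ A} σ_x` over a finite set of sites (Friedli–Velenik 2017,
§3.6.1, notation `σ_A`). [cite: FriedliVelenik2017, §3.6.1  notation  σ_A] -/
def spinProduct (A : Finset V) (s : SpinConfig V) : ℝ :=
  ∏ x ∈ A, spinAt x s

/-- The spin monomial `∏ i, σ_{x i}` of an indexed family of sites (repetitions allowed, so that
`σ_x σ_x = 1`); this is the integrand of `nPoint μ spinAt x` (Glimm–Jaffe 1987, §4.2). [cite: GlimmJaffe1987, §4.2] -/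
def spinMonomial {n : ℕ} (x : Fin n → V) (s : SpinConfig V) : ℝ :=
  ∏ i, spinAt (x i) s

/-- The pair product `σ_x σ_y` (Friedli–Velenik 2017, §3.2). [cite: FriedliVelenik2017, §3.2] -/
def spinPair (x y : V) (s : SpinConfig V) : ℝ :=
  spinAt x s * spinAt y s

/-- The set-indexed spin correlation `⟨σ_A⟩_μ = ∫ σ_A ∂μ` (Friedli–Velenik 2017, §3.6.1). Used
only where the informal text has a *set* `A` (GKS inequalities); two-point functions are
`spinTwoPoint`. [cite: FriedliVelenik2017, §3.6.1] -/
def spinCorr (μ : Measure (SpinConfig V)) (A : Finset V) : ℝ :=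
  ∫ s, spinProduct A s ∂μ

/-- The spin two-point function `⟨σ_x σ_y⟩_μ = ∫ σ_x σ_y ∂μ`, an expectation of a product
(Friedli–Velenik 2017, §3.2, eq. (3.19)); equals `twoPoint μ spinAt x y`. [cite: FriedliVelenik2017, §3.2  eq. (3.19] -/
def spinTwoPoint (μ : Measure (SpinConfig V)) (x y : V) : ℝ :=
  ∫ s, spinPair x y s ∂μ

/-- `spinTwoPoint` is the generic two-point function of the field `spinAt`
(Glimm–Jaffe 1987, §4.2). [cite: GlimmJaffe1987, §4.2] -/
theorem spinTwoPoint_eq_twoPoint (μ : Measure (SpinConfig V))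
    (x y : V) : spinTwoPoint μ x y = twoPoint μ spinAt x y := rfl

/-- `spinCorr` is the expectation of `spinProduct` written with Mathlib's `μ[·]` notation
(Friedli–Velenik 2017, §3.6.1). [cite: FriedliVelenik2017, §3.6.1] -/
theorem spinCorr_eq_integral (μ : Measure (SpinConfig V))
    (A : Finset V) : spinCorr μ A = μ[spinProduct A] := rfl

/-- A spin takes only the values `1` and `-1` (Friedli–Velenik 2017, §3.1). [cite: FriedliVelenik2017, §3.1] -/
theorem spinAt_eq_one_or_eq_neg_one (x : V) (s : SpinConfig V) :
    spinAt x s = 1 ∨ spinAt x s = -1 := by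
  rcases Int.units_eq_one_or (s x) with h | h <;> simp [spinAt, h]

/-- `σ_x ^ 2 = 1` (Friedli–Velenik 2017, §3.1). [cite: FriedliVelenik2017, §3.1] -/
@[simp] theorem spinAt_sq (x : V) (s : SpinConfig V) : spinAt x s ^ 2 = 1 := by
  rcases spinAt_eq_one_or_eq_neg_one x s with h | h <;> simp [h]

/-- `σ_x * σ_x = 1` (Friedli–Velenik 2017, §3.1). [cite: FriedliVelenik2017, §3.1] -/
@[simp] theorem spinAt_mul_self (x : V) (s : SpinConfig V) : spinAt x s * spinAt x s = 1 := by
  rw [← sq, spinAt_sq]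

/-- `|σ_x| = 1` (Friedli–Velenik 2017, §3.1). [cite: FriedliVelenik2017, §3.1] -/
@[simp] theorem abs_spinAt (x : V) (s : SpinConfig V) : |spinAt x s| = 1 := by
  rcases spinAt_eq_one_or_eq_neg_one x s with h | h <;> simp [h]

/-- `|σ_A| = 1`, in particular `|σ_A| ≤ 1` (Friedli–Velenik 2017, §3.6.1). [cite: FriedliVelenik2017, §3.6.1] -/
theorem abs_spinProduct (A : Finset V) (s : SpinConfig V) : |spinProduct A s| = 1 := by
  simp [spinProduct, Finset.abs_prod]

/-- `|σ_A| ≤ 1` (Friedli–Velenik 2017, §3.6.1). [cite: FriedliVelenik2017, §3.6.1] -/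
theorem abs_spinProduct_le_one (A : Finset V) (s : SpinConfig V) : |spinProduct A s| ≤ 1 :=
  (abs_spinProduct A s).le

/-- `σ_x σ_x = 1`, so the diagonal pair observable is the constant `1`
(Friedli–Velenik 2017, §3.2). [cite: FriedliVelenik2017, §3.2] -/
@[simp] theorem spinPair_self (x : V) : spinPair x x = fun _ : SpinConfig V => (1 : ℝ) := by
  funext s
  simp [spinPair]

/-- Flipping all spins multiplies `σ_A` by `(-1)^{|A|}` (spin-flip symmetry;
Friedli–Velenik 2017, §3.6 and §3.7.1). [cite: FriedliVelenik2017, §3.6 and §3.7.1] -/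
theorem spinProduct_neg (A : Finset V) (s : SpinConfig V) :
    spinProduct A (-s) = (-1) ^ A.card * spinProduct A s := by
  simp [spinProduct, spinAt, Units.val_neg, Finset.prod_neg]

/-- `spinAt x` is monotone for the product order on `SpinConfig V` induced by `-1 < 1` in `ℤˣ`;
this is the order used in the FKG inequality (Friedli–Velenik 2017, §3.6.2). [cite: FriedliVelenik2017, §3.6.2] -/
theorem spinAt_mono (x : V) : Monotone (spinAt (V := V) x) := by
  intro s t hst
  have h : s x ≤ t x := hst x
  simp only [spinAt, Int.cast_le]
  exact Units.val_le_val.mpr h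

/-- Under a probability measure the diagonal of the spin two-point function is `1`, since
`σ_x σ_x = 1`; this is why two-point functions are never written `spinCorr μ {x, y}`
(Friedli–Velenik 2017, §3.2). [cite: FriedliVelenik2017, §3.2] -/
@[simp] theorem spinTwoPoint_self (μ : Measure (SpinConfig V)) [IsProbabilityMeasure μ] (x : V) :
    spinTwoPoint μ x x = 1 := by
  simp [spinTwoPoint]

/-- `|⟨σ_A⟩_μ| ≤ 1` for a probability measure `μ` (Friedli–Velenik 2017, §3.6.1). [cite: FriedliVelenik2017, §3.6.1] -/
theorem abs_spinCorr_le_one (μ : Measure (SpinConfig V)) [IsProbabilityMeasure μ] (A : Finset V) :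
    |spinCorr μ A| ≤ 1 := by
  simp only [spinCorr]
  calc |∫ s, spinProduct A s ∂μ| ≤ ∫ s, |spinProduct A s| ∂μ := abs_integral_le_integral_abs
    _ = 1 := by simp [abs_spinProduct]

end Spin

/-! ### Measurability of spin observables (product σ-algebra) -/

section Measurable

variable {V : Type*}

/-- `σ ↦ σ_x` is measurable for the product σ-algebra on `V → ℤˣ` (`ℤˣ` discrete)
(Friedli–Velenik 2017, §6.2). [cite: FriedliVelenik2017, §6.2] -/
@[fun_prop]
theorem measurable_spinAt (x : V) : Measurable (spinAt (V := V) x) :=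
  (measurable_of_countable (fun u : ℤˣ => ((u : ℤ) : ℝ))).comp (measurable_pi_apply x)

/-- `σ ↦ σ_A` is measurable (Friedli–Velenik 2017, §6.2). [cite: FriedliVelenik2017, §6.2] -/
@[fun_prop]
theorem measurable_spinProduct (A : Finset V) : Measurable (spinProduct (V := V) A) := by
  unfold spinProduct
  exact Finset.measurable_prod _ fun x _ => measurable_spinAt x

/-- `σ ↦ ∏ i, σ_{x i}` is measurable (Friedli–Velenik 2017, §6.2). [cite: FriedliVelenik2017, §6.2] -/
@[fun_prop]
theorem measurable_spinMonomial {n : ℕ} (x : Fin n → V) :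
    Measurable (spinMonomial (V := V) x) := by
  unfold spinMonomial
  exact Finset.measurable_prod _ fun i _ => measurable_spinAt (x i)

/-- `σ ↦ σ_x σ_y` is measurable (Friedli–Velenik 2017, §6.2). [cite: FriedliVelenik2017, §6.2] -/
@[fun_prop]
theorem measurable_spinPair (x y : V) : Measurable (spinPair (V := V) x y) :=
  (measurable_spinAt x).mul (measurable_spinAt y)

/-- Spin observables are bounded by `1`, hence integrable under any finite measure
(Friedli–Velenik 2017, §6.2). [cite: FriedliVelenik2017, §6.2] -/
theorem integrable_spinProduct (μ : Measure (SpinConfig V)) [IsFiniteMeasure μ] (A : Finset V) :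
    Integrable (spinProduct A) μ :=
  Integrable.of_bound (measurable_spinProduct A).aestronglyMeasurable 1
    (Filter.Eventually.of_forall fun s => by
      rw [Real.norm_eq_abs]; exact abs_spinProduct_le_one A s)

end Measurable

end Literature.Probability.LatticeModels
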